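/-
Speedrun cell sr-mbsolver — LEAN team (lit-4 gen-3), D-18 r72(c): helper lemmas for the PRIMAL-form lane-B transports
(`Transport/LTIPrimalSpinChain.lean`, THEOREM B0 of `sr-mbsolver-lit-4/THEOREM-B.md`).
HONEST FRAMING: first certified bounds; not a superconductivity verdict; every number certified or labelled float.

Contents (all folklore linear algebra on the tree's spin-system vocabulary, no new facts):
1. the spin matrices `S⁺, S⁻, Sˣ, Sᶻ` have real entries and `Sʸ` purely imaginary ones, hence the exchange operator
   `𝐒_x · 𝐒_y` has real entries and is symmetric (`spinDot_map_conj`, `spinDot_transpose`) [cite: Tasaki2020, §2.1, §2.4];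
2. `Sᶻ_tot` is diagonal in the product basis (`totalSpin_two_eq_diagonal`) and the tracial ground state of a Hermitian `A`
   satisfies `ω₀(D X) = ω₀(X D)` for every `D` commuting with `A` [cite: Tasaki2020, §2.1–2.2];
3. entries of a density matrix are bounded by one (`norm_apply_le_one_of_posSemidef`, `2 × 2` principal minors) [folklore];
4. `tr_L`, `tr_R` of a chain window commute with transposition [folklore].
-/
import Literature.MathematicalPhysics.QuantumLattice.SpinPartialTrace
import Literature.MathematicalPhysics.QuantumLattice.FinDimSpectrumProofs
import HarnessLib

noncomputable section

open Matrix Complex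
open scoped ComplexOrder
open Literature.MathematicalPhysics.QuantumLattice

namespace Summit.Ventures.CertifiedManyBodySolver.Transport

/-! ### 1. Real entries: the spin matrices, the exchange operator -/

section RealEntries

variable {Λ : Type*} [Fintype Λ] [DecidableEq Λ]

/-- `c • M` under entrywise conjugation. [folklore] -/
theorem map_conj_smul {ι : Type*} (c : ℂ) (M : Matrix ι ι ℂ) :
    (c • M).map (starRingEnd ℂ) = starRingEnd ℂ c • M.map (starRingEnd ℂ) := by
  ext i j
  simp

/-- `M + N` under entrywise conjugation. [folklore] -/
theorem map_conj_add {ι : Type*} (M N : Matrix ι ι ℂ) :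
    (M + N).map (starRingEnd ℂ) = M.map (starRingEnd ℂ) + N.map (starRingEnd ℂ) := by
  ext i j
  simp

/-- `M - N` under entrywise conjugation. [folklore] -/
theorem map_conj_sub {ι : Type*} (M N : Matrix ι ι ℂ) :
    (M - N).map (starRingEnd ℂ) = M.map (starRingEnd ℂ) - N.map (starRingEnd ℂ) := by
  ext i j
  simp

/-- A finite sum under entrywise conjugation. [folklore] -/
theorem map_conj_sum {ι κ : Type*} (S : Finset κ) (M : κ → Matrix ι ι ℂ) :
    (∑ k ∈ S, M k).map (starRingEnd ℂ) = ∑ k ∈ S, (M k).map (starRingEnd ℂ) := by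
  ext i j
  simp [Matrix.sum_apply]

/-- `onSite x a` under an entrywise ring map. [folklore] -/
theorem onSite_map {q : ℕ} (x : Λ) (a : Matrix (Fin q) (Fin q) ℂ) (f : ℂ →+* ℂ) :
    (onSite x a : Op Λ q).map f = onSite x (a.map f) := by
  ext σ τ
  simp only [Matrix.map_apply, onSite_apply]
  split_ifs <;> simp

/-- `S⁺` has real entries. [cite: Tasaki2020, §2.1 eq. (2.1.6)] -/
theorem spinRaise_map_conj (n : ℕ) : (spinRaise n).map (starRingEnd ℂ) = spinRaise n := by
  ext k l
  simp only [Matrix.map_apply, spinRaise, Matrix.of_apply]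
  split_ifs <;> simp [Complex.conj_ofReal]

/-- `S⁻ = (S⁺)ᴴ` has real entries. [cite: Tasaki2020, §2.1 eq. (2.1.6)] -/
theorem spinLower_map_conj (n : ℕ) : (spinLower n).map (starRingEnd ℂ) = spinLower n := by
  ext k l
  have h := congrFun (congrFun (spinRaise_map_conj n) l) k
  simp only [Matrix.map_apply] at h
  simp only [Matrix.map_apply, spinLower, conjTranspose_apply, Complex.star_def, h]

/-- `Sᶻ` has real entries. [cite: Tasaki2020, §2.1 eq. (2.1.5)] -/
theorem spinZ_map_conj (n : ℕ) : (SpinOperators.spinZ n).map (starRingEnd ℂ) = SpinOperators.spinZ n := by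
  ext k l
  simp only [Matrix.map_apply, SpinOperators.spinZ, diagonal_apply]
  split_ifs <;> simp [map_ofNat]

/-- `Sˣ` has real entries. [cite: Tasaki2020, §2.1 eq. (2.1.6)] -/
theorem spinX_map_conj (n : ℕ) : (spinX n).map (starRingEnd ℂ) = spinX n := by
  rw [spinX, map_conj_smul, map_conj_add, spinRaise_map_conj, spinLower_map_conj]
  congr 1
  rw [map_div₀, map_one, map_ofNat]

/-- `Sʸ` has purely imaginary entries. [cite: Tasaki2020, §2.1 eq. (2.1.6)] -/
theorem spinY_map_conj (n : ℕ) : (spinY n).map (starRingEnd ℂ) = -spinY n := by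
  rw [spinY, map_conj_smul, map_conj_sub, spinRaise_map_conj, spinLower_map_conj, ← neg_smul]
  congr 1
  rw [map_div₀, map_one, map_mul, Complex.conj_I, map_ofNat, mul_neg, div_neg]

/-- The sign `ε_α ∈ {1, -1, 1}` picked up by `S^α` under complex conjugation squares to one. [folklore] -/
theorem conjSign_mul_self (α : Fin 3) : (![1, -1, 1] : Fin 3 → ℂ) α * (![1, -1, 1] : Fin 3 → ℂ) α = 1 := by
  fin_cases α <;> simp

/-- `conj (S^α) = ε_α S^α`, `ε = (1, -1, 1)`. [cite: Tasaki2020, §2.1] -/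
theorem spinVec_map_conj (n : ℕ) (α : Fin 3) :
    (spinVec n α).map (starRingEnd ℂ) = (![1, -1, 1] : Fin 3 → ℂ) α • spinVec n α := by
  fin_cases α
  · simp [spinX_map_conj]
  · simp [spinY_map_conj]
  · simp [spinZ_map_conj]

/-- `conj (S^α_x) = ε_α S^α_x`. [cite: Tasaki2020, §2.2] -/
theorem siteSpin_map_conj (n : ℕ) (x : Λ) (α : Fin 3) :
    (siteSpin n x α : Op Λ (n + 1)).map (starRingEnd ℂ) = (![1, -1, 1] : Fin 3 → ℂ) α • siteSpin n x α := by
  rw [siteSpin, onSite_map, spinVec_map_conj, onSite_smul']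

/-- The bond operators `½(S^α_x S^α_y + S^α_y S^α_x)` have real entries. [cite: Tasaki2020, §2.4] -/
theorem spinBond_map_conj (n : ℕ) (α : Fin 3) (x y : Λ) :
    (spinBond n α x y : Op Λ (n + 1)).map (starRingEnd ℂ) = spinBond n α x y := by
  have hmul : ∀ (A B : Op Λ (n + 1)), (A * B).map (starRingEnd ℂ) = A.map (starRingEnd ℂ) * B.map (starRingEnd ℂ) :=
    fun A B => Matrix.map_mul
  rw [spinBond, map_conj_smul, map_conj_add, hmul, hmul, siteSpin_map_conj, siteSpin_map_conj,
    smul_mul_smul_comm, smul_mul_smul_comm, conjSign_mul_self, one_smul, one_smul]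
  congr 1
  rw [map_div₀, map_one, map_ofNat]

/-- **The exchange operator `𝐒_x · 𝐒_y` has real entries.** [cite: Tasaki2020, §2.4] -/
theorem spinDot_map_conj (n : ℕ) (x y : Λ) :
    (spinDot n x y : Op Λ (n + 1)).map (starRingEnd ℂ) = spinDot n x y := by
  rw [spinDot, map_conj_sum]
  exact Finset.sum_congr rfl fun α _ => spinBond_map_conj n α x y

/-- A Hermitian matrix with real entries is symmetric. [folklore] -/
theorem transpose_eq_of_isHermitian_of_map_conj {ι : Type*} {M : Matrix ι ι ℂ} (hM : M.IsHermitian)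
    (hr : M.map (starRingEnd ℂ) = M) : Mᵀ = M := by
  ext i j
  have h1 := hM.apply i j
  have h2 := congrFun (congrFun hr j) i
  simp only [Matrix.map_apply] at h2
  rw [transpose_apply, ← h1, Complex.star_def, h2]

/-- **`(𝐒_x · 𝐒_y)ᵀ = 𝐒_x · 𝐒_y`.** [cite: Tasaki2020, §2.4] -/
theorem spinDot_transpose (n : ℕ) (x y : Λ) : (spinDot n x y : Op Λ (n + 1))ᵀ = spinDot n x y :=
  transpose_eq_of_isHermitian_of_map_conj (spinDot_isHermitian n x y) (spinDot_map_conj n x y)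

end RealEntries

/-! ### 2. `Sᶻ_tot` is diagonal in the product basis; sectors -/

section Sector

variable {Λ : Type*} [Fintype Λ] [DecidableEq Λ]

/-- A diagonal single-site matrix placed at `x` is diagonal. [folklore] -/
theorem onSite_diagonal {q : ℕ} (x : Λ) (f : Fin q → ℂ) :
    (onSite x (diagonal f) : Op Λ q) = diagonal fun σ => f (σ x) := by
  ext σ τ
  simp only [onSite_apply, diagonal_apply]
  by_cases h : σ = τ
  · subst h
    simp
  · rw [if_neg h]
    split_ifs with h1 h2
    · exact absurd (funext fun y => if hy : y = x then hy ▸ h2 else h1 y hy) h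
    · rfl
    · rfl

/-- **`Sᶻ_tot = diag(Σ_x (n/2 - σ_x))`** in the product basis. [cite: Tasaki2020, §2.2 eq. (2.2.11)] -/
theorem totalSpin_two_eq_diagonal (n : ℕ) :
    (totalSpin n 2 : Op Λ (n + 1)) = diagonal fun σ => ∑ x, ((n : ℂ) / 2 - ((σ x : ℕ) : ℂ)) := by
  ext σ τ
  rw [totalSpin, Matrix.sum_apply, diagonal_apply]
  simp only [siteSpin, spinVec_two, SpinOperators.spinZ, onSite_diagonal, diagonal_apply]
  split_ifs with h
  · rfl
  · simp

/-- `[diag d, e_{st}] = (d_s - d_t) e_{st}`. [folklore] -/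
theorem diagonal_commutator_single {ι : Type*} [Fintype ι] [DecidableEq ι] (d : ι → ℂ) (s t : ι) :
    diagonal d * Matrix.single s t (1 : ℂ) - Matrix.single s t 1 * diagonal d = (d s - d t) • Matrix.single s t 1 := by
  ext i j
  rw [Matrix.sub_apply, Matrix.diagonal_mul, Matrix.mul_diagonal, Matrix.smul_apply, Matrix.single_apply, smul_eq_mul]
  split_ifs with h
  · rw [h.1, h.2]; ring
  · ring

omit [DecidableEq Λ] in
/-- Difference of magnetisations = difference of the `ℕ`-sums of the configurations (opposite sign). [folklore] -/
theorem magnetisation_sub (n : ℕ) (s t : TensorIndex Λ (n + 1)) :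
    (∑ x, ((n : ℂ) / 2 - ((s x : ℕ) : ℂ))) - (∑ x, ((n : ℂ) / 2 - ((t x : ℕ) : ℂ))) =
      ((∑ x, (t x : ℕ) : ℕ) : ℂ) - ((∑ x, (s x : ℕ) : ℕ) : ℂ) := by
  simp only [Nat.cast_sum, ← Finset.sum_sub_distrib]
  exact Finset.sum_congr rfl fun x _ => by ring

/-- `ω₀(D X) = ω₀(X D)` for the tracial ground state of a Hermitian `A` and any `D` commuting with `A`. [cite: Tasaki2020, §2.1] -/
theorem groundStateFunctional_mul_comm_of_commute {ι : Type*} [Fintype ι] [DecidableEq ι] {A D : Matrix ι ι ℂ}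
    (hA : A.IsHermitian) (hD : D * A = A * D) (X : Matrix ι ι ℂ) :
    A.groundStateFunctional (D * X) = A.groundStateFunctional (X * D) := by
  rw [groundStateFunctional_apply, groundStateFunctional_apply, ← mul_assoc, groundProj_commute_of_commute hA hD,
    mul_assoc, trace_mul_comm D, mul_assoc]

end Sector

/-! ### 3. Entries of a density matrix are bounded by one -/

section EntryBound

variable {ι : Type*} [Fintype ι] [DecidableEq ι]

omit [DecidableEq ι] in
/-- Diagonal entries of a PSD trace-one matrix lie in `[0, 1]` (as complex numbers). [folklore] -/
theorem apply_self_le_one_of_posSemidef {ρ : Matrix ι ι ℂ} (hρ : ρ.PosSemidef) (htr : ρ.trace = 1) (i : ι) :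
    ρ i i ≤ 1 := by
  rw [← htr, Matrix.trace]
  exact Finset.single_le_sum (f := fun j => ρ j j) (fun j _ => hρ.diag_nonneg) (Finset.mem_univ i)

/-- **`|ρ_{ts}| ≤ 1` for a density matrix** (`2 × 2` principal minors). [folklore] -/
theorem norm_apply_le_one_of_posSemidef {ρ : Matrix ι ι ℂ} (hρ : ρ.PosSemidef) (htr : ρ.trace = 1) (t s : ι) :
    ‖ρ t s‖ ≤ 1 := by
  have hd : ∀ i, 0 ≤ (ρ i i).re ∧ (ρ i i).re ≤ 1 ∧ (ρ i i).im = 0 := by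
    intro i
    have h0 : (0 : ℂ) ≤ ρ i i := hρ.diag_nonneg
    have h1 : ρ i i ≤ 1 := apply_self_le_one_of_posSemidef hρ htr i
    rw [Complex.le_def] at h0 h1
    simp only [Complex.zero_re, Complex.zero_im, Complex.one_re, Complex.one_im] at h0 h1
    exact ⟨h0.1, h1.1, h0.2.symm⟩
  by_cases hts : t = s
  · subst hts
    obtain ⟨h0, h1, him⟩ := hd t
    have : ‖ρ t t‖ = (ρ t t).re := by
      rw [← Complex.re_add_im (ρ t t), him]
      simp [abs_of_nonneg h0]
    rw [this]
    exact h1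
  · -- the principal `2 × 2` minor on `{t, s}`
    have hS := (hρ.submatrix ![t, s]).det_nonneg
    rw [det_fin_two] at hS
    simp only [submatrix_apply, Matrix.cons_val_zero, Matrix.cons_val_one] at hS
    have hst : ρ s t = starRingEnd ℂ (ρ t s) := by
      have := hρ.1.apply s t
      rw [← this, Complex.star_def]
    rw [hst, Complex.mul_conj, Complex.le_def] at hS
    simp only [Complex.zero_re, Complex.sub_re, Complex.mul_re, Complex.ofReal_re] at hS
    obtain ⟨_, _, hti⟩ := hd t
    obtain ⟨hs0, hs1, hsi⟩ := hd s
    obtain ⟨ht0, ht1, _⟩ := hd t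
    rw [hti, hsi, mul_zero, sub_zero] at hS
    have hsq : ‖ρ t s‖ ^ 2 ≤ 1 := by
      rw [← Complex.normSq_eq_norm_sq]
      nlinarith [hS.1, mul_le_one₀ ht1 hs0 hs1]
    exact (sq_le_one_iff₀ (norm_nonneg _)).1 hsq

end EntryBound

/-! ### 4. Transposes of window marginals -/

section Transpose

variable {q m : ℕ}

/-- `tr_L (ρᵀ) = (tr_L ρ)ᵀ`. [folklore] -/
theorem spinPartialTrace_succEmb_transpose (ρ : Op (Fin (m + 1)) q) :
    spinPartialTrace (Fin.succEmb m) ρᵀ = (spinPartialTrace (Fin.succEmb m) ρ)ᵀ := by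
  ext t s
  simp only [transpose_apply, spinPartialTrace_succEmb_apply]

/-- `tr_R (ρᵀ) = (tr_R ρ)ᵀ`. [folklore] -/
theorem spinPartialTrace_castSuccEmb_transpose (ρ : Op (Fin (m + 1)) q) :
    spinPartialTrace Fin.castSuccEmb ρᵀ = (spinPartialTrace Fin.castSuccEmb ρ)ᵀ := by
  ext t s
  simp only [transpose_apply, spinPartialTrace_castSuccEmb_apply]

end Transpose

end Summit.Ventures.CertifiedManyBodySolver.Transport
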